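import Summits.QuantumFields.YangMills.Theorems.FluctuationComparisonRegPrIntLOrganTangentFibreVarianceSquareKnit
import Summits.QuantumFields.YangMills.Theorems.FluctuationComparisonRegPrIntLOrganTangentFibreMeanCovarianceReading
import HarnessLib

/-!
# Crux `FluctuationComparisonRegPrIntL` (stmt-QuantumFields-20520, rung R3), PATH-B v18 organ O1ᵘ-H v2, JENSEN SIDE (JVARᵘ-H road):
# **THE VARIANCE SQUARE KNIT READ PER LOCAL PIECE** — every channel of ✓p809127 `fibreVar_secondDiff_eq` as a finite sum of PINNED-LEG PAIRINGS for
# `F_ab = Σ_p c_p·f_ab p` (TN-COV-3 ∕ (κ≤3): no global `√Var`; the slots where the truncated-correlation decay letters of FIBRE-LAW-H enter BY HYPOTHESIS)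

Cell `ym3-torus` (rung R3 = continuum `SU(2)` Yang–Mills on T³ — NOT d = 4, NOT infinite volume, NOT a mass gap, NOT Clay), width copy `ym3-torus-px5` (gen 19).
`--kind proof --supports stmt-QuantumFields-20520 --as helper`, count-neutral, DEFINITION-FREE, default heartbeats, `autoImplicit false`; THEOREMS ONLY on ONE abstract
fibre `(Ω, P)`; no registry ∕ binder ∕ `Lines/` edit.  The Jensen-side twin of LEAD w3 g25's ✓B3 §3′ `abs_fibreMean_secondDiff_le_cov_split` (whose
`abs_integral_sum_centred_mul_le` it reuses BY NAME).

WHAT.  With `u_ab := F_ab − m_ab`, pieces `F_ab ξ = Σ_{p∈s} c p·f_ab p ξ`, centrings `m_ab = Σ_{p∈s} c p·fb_ab p` (so `u_ab = Σ_p c p·(f_ab p − fb_ab p)`), and ANY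
constants `κ p q` (in the consumer: the base-law covariances `∫ (f₀₀ p − fb₀₀ p)(f₀₀ q − fb₀₀ q)·ŵ₀₀`, making the last slot a CONNECTED three-point pairing):
* §1 `abs_integral_sqsum_centred_mul_le` — the quadratic analogue of B3's `abs_integral_sum_centred_mul_le`:
  `|∫ ((F − m)² − Σ_p Σ_q c p·c q·κ p q)·u| ≤ Σ_p Σ_q |c p|·|c q|·|∫ ((f p − fb p)(f q − fb q) − κ p q)·u|` (pure algebra + linearity of the integral);
* §2 ★★`abs_fibreVar_secondDiff_le_slots` — `|ΔΔ v| ≤ Σ_p |c p|·|∫ (fS p − fbS p)·((ΔΔF − ΔΔm)·ŵ₁₁)|` (PULL-BACK 1; `fS p := f₁₁ p + f₁₀ p + f₀₁ p − f₀₀ p`, pinned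
  leg `ΔΔF − ΔΔm`) `+ 2·|∫ (Δ₁F − Δ₁m)(Δ₂F − Δ₂m)·ŵ₁₁|` (PULL-BACK 2, both legs pinned) `+ Σ_p |c p|·|∫ (f₁₀ p + f₀₀ p − (fb₁₀ p + fb₀₀ p))·((Δ₁F − Δ₁m)·(ŵ₁₁ − ŵ₁₀))|`
  `+ Σ_p |c p|·|∫ (f₀₁ p + f₀₀ p − (fb₀₁ p + fb₀₀ p))·((Δ₂F − Δ₂m)·(ŵ₁₁ − ŵ₀₁))|` (CROSS ×2: pinned first difference × piece × RN first variation — order-3 slots)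
  `+ Σ_p Σ_q |c p|·|c q|·|∫ ((f₀₀ p − fb₀₀ p)(f₀₀ q − fb₀₀ q) − κ p q)·(ŵ₁₁ − ŵ₁₀ − ŵ₀₁ + ŵ₀₀)|` (CENTRED: piece × piece × RN second variation — the
  connected three-point slot).  Every slot has ≥ 1 leg pinned at the moved bonds; the piece sums `Σ_p` are what the decay letters make volume-uniform.
NOT HERE: the letters themselves (FIBRE-LAW-H (χ)(κ≤3)(τ), SPREAD-TRANSPORT-H — ideator g28's texts), the good∕bad tail split (✓BRICK TS applies to the two
PULL-BACK slots verbatim), the Jensen knit «JVARᵘ-H ⟸ …» (docks on the texts).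

HONEST FRAMING: finite-sum bookkeeping over HYPOTHESIS data ([folklore]); transports ∕ weights ∕ letters for the runs NOT constructed; nothing of Bałaban's analysis is
asserted or proved; JVARᵘ-H, LINᵘ-H, O1ᵘ-H v2 ∕ v2.1, S1aᴴ, crux 20520, `YM3TorusSU2` are NOT proved; registry `Lines/semiclassical_s2beta.lean` v11.4 (★★OWNER RULING №36)
and `Lines/runpair_organ.lean` untouched, nothing here is registered; rung R3 = SU(2) YM₃ on T³ — NOT d = 4, NOT infinite volume, NOT a mass gap, NOT Clay; the
Yang–Mills mass gap is NOT proved by any of this.  Credit: LEAD w3 g25 (B3 §3′'s pattern and lemma, reused by name).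
-/

set_option autoImplicit false

noncomputable section

namespace Summit.QuantumFields.YangMills.Theorems.FluctuationComparisonRegPrIntLOrganTangentFibreVarianceSquareSlots

open MeasureTheory
open Summit.QuantumFields.YangMills.Theorems.OrganTangentFibreMeanSquareKnit (integrable_bdd_mul)
open Summit.QuantumFields.YangMills.Theorems.OrganTangentFibreMeanCovarianceReading (abs_integral_sum_centred_mul_le)
open Summit.QuantumFields.YangMills.Theorems.FluctuationComparisonRegPrIntLOrganTangentFibreVarianceSquareKnit (fibreVar_secondDiff_eq)

variable {Ω : Type*} [MeasurableSpace Ω]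

/-! ## §1 The quadratic per-piece split -/

/-- **QUADRATIC PER-PIECE SPLIT**: for `F = Σ_{p∈s} c p·f p` pointwise, `m = Σ_{p∈s} c p·fb p`, any constants `κ p q` and an integrable `u`:
`|∫ ((F − m)² − Σ_p Σ_q c p·c q·κ p q)·u| ≤ Σ_p Σ_q |c p|·|c q|·|∫ ((f p − fb p)·(f q − fb q) − κ p q)·u|`. [folklore] -/
theorem abs_integral_sqsum_centred_mul_le {ι : Type*} (P : Measure Ω) (s : Finset ι) (c fb : ι → ℝ) (f : ι → Ω → ℝ) (κ : ι → ι → ℝ)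
    (F u : Ω → ℝ) (m Mf : ℝ)
    (hfm : ∀ p, AEStronglyMeasurable (f p) P) (hfb : ∀ p ξ, |f p ξ| ≤ Mf) (hu : Integrable u P)
    (hF : ∀ ξ, F ξ = ∑ p ∈ s, c p * f p ξ) (hm : m = ∑ p ∈ s, c p * fb p) :
    |∫ ξ, ((F ξ - m) ^ 2 - ∑ p ∈ s, ∑ q ∈ s, c p * c q * κ p q) * u ξ ∂P|
      ≤ ∑ p ∈ s, ∑ q ∈ s, |c p| * |c q| * |∫ ξ, ((f p ξ - fb p) * (f q ξ - fb q) - κ p q) * u ξ ∂P| := by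
  have hint : ∀ p q, Integrable (fun ξ => ((f p ξ - fb p) * (f q ξ - fb q) - κ p q) * u ξ) P := by
    intro p q
    refine integrable_bdd_mul (M := (Mf + |fb p|) * (Mf + |fb q|) + |κ p q|) ?_ (fun ξ => ?_) hu
    · exact ((((hfm p).sub aestronglyMeasurable_const).mul ((hfm q).sub aestronglyMeasurable_const)).sub
        aestronglyMeasurable_const)
    · have h1 : |f p ξ - fb p| ≤ Mf + |fb p| := (abs_sub _ _).trans (add_le_add (hfb p ξ) le_rfl)
      have h2 : |f q ξ - fb q| ≤ Mf + |fb q| := (abs_sub _ _).trans (add_le_add (hfb q ξ) le_rfl)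
      calc |(f p ξ - fb p) * (f q ξ - fb q) - κ p q|
          ≤ |(f p ξ - fb p) * (f q ξ - fb q)| + |κ p q| := abs_sub _ _
        _ ≤ (Mf + |fb p|) * (Mf + |fb q|) + |κ p q| := by
            rw [abs_mul]
            exact add_le_add (mul_le_mul h1 h2 (abs_nonneg _) ((abs_nonneg _).trans h1)) le_rfl
  -- pointwise: `(F − m)² − ΣΣ c c κ = ΣΣ c c ((f − fb)(f − fb) − κ)`
  have hpt : (fun ξ => ((F ξ - m) ^ 2 - ∑ p ∈ s, ∑ q ∈ s, c p * c q * κ p q) * u ξ)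
      = fun ξ => ∑ p ∈ s, ∑ q ∈ s, c p * c q * (((f p ξ - fb p) * (f q ξ - fb q) - κ p q) * u ξ) := by
    funext ξ
    have hd : F ξ - m = ∑ p ∈ s, c p * (f p ξ - fb p) := by
      rw [hF ξ, hm, ← Finset.sum_sub_distrib]
      exact Finset.sum_congr rfl (fun p _ => by ring)
    rw [hd, sq, Finset.sum_mul_sum, ← Finset.sum_sub_distrib, Finset.sum_mul]
    refine Finset.sum_congr rfl (fun p _ => ?_)
    rw [← Finset.sum_sub_distrib, Finset.sum_mul]
    exact Finset.sum_congr rfl (fun q _ => by ring)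
  rw [hpt, integral_finsetSum s (fun p _ => integrable_finsetSum s (fun q _ => (hint p q).const_mul (c p * c q)))]
  refine (Finset.abs_sum_le_sum_abs _ _).trans (Finset.sum_le_sum (fun p _ => ?_))
  rw [integral_finsetSum s (fun q _ => (hint p q).const_mul (c p * c q))]
  refine (Finset.abs_sum_le_sum_abs _ _).trans (Finset.sum_le_sum (fun q _ => ?_))
  rw [integral_const_mul, abs_mul, abs_mul]

/-! ## §2 The variance square knit read per local piece -/

/-- ★★ **THE VARIANCE SQUARE KNIT, READ PER LOCAL PIECE** (see the module docstring): the five channels of ✓`fibreVar_secondDiff_eq` (at `c₁ = c₂ = 0`,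
`c₀ = Σ_p Σ_q c p·c q·κ p q`) bounded by finite sums of pinned-leg pairings over the pieces of `F_ab = Σ_{p∈s} c p·f_ab p` with centrings `m_ab = Σ_{p∈s} c p·fb_ab p`. [folklore] -/
theorem abs_fibreVar_secondDiff_le_slots {ι : Type*} (P : Measure Ω)
    (F₀₀ F₁₀ F₀₁ F₁₁ w₀₀ w₁₀ w₀₁ w₁₁ : Ω → ℝ) (M m₀₀ m₁₀ m₀₁ m₁₁ : ℝ)
    (s : Finset ι) (c : ι → ℝ) (f₀₀ f₁₀ f₀₁ f₁₁ : ι → Ω → ℝ) (fb₀₀ fb₁₀ fb₀₁ fb₁₁ : ι → ℝ) (κ : ι → ι → ℝ) (Mf : ℝ)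
    (hF₀₀ : AEStronglyMeasurable F₀₀ P) (hF₁₀ : AEStronglyMeasurable F₁₀ P)
    (hF₀₁ : AEStronglyMeasurable F₀₁ P) (hF₁₁ : AEStronglyMeasurable F₁₁ P)
    (hb₀₀ : ∀ ξ, |F₀₀ ξ| ≤ M) (hb₁₀ : ∀ ξ, |F₁₀ ξ| ≤ M) (hb₀₁ : ∀ ξ, |F₀₁ ξ| ≤ M) (hb₁₁ : ∀ ξ, |F₁₁ ξ| ≤ M)
    (hw₀₀ : Integrable w₀₀ P) (hw₁₀ : Integrable w₁₀ P) (hw₀₁ : Integrable w₀₁ P) (hw₁₁ : Integrable w₁₁ P)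
    (hn₀₀ : ∫ ξ, w₀₀ ξ ∂P = 1) (hn₁₀ : ∫ ξ, w₁₀ ξ ∂P = 1) (hn₀₁ : ∫ ξ, w₀₁ ξ ∂P = 1) (hn₁₁ : ∫ ξ, w₁₁ ξ ∂P = 1)
    (hfm₀₀ : ∀ p, AEStronglyMeasurable (f₀₀ p) P) (hfm₁₀ : ∀ p, AEStronglyMeasurable (f₁₀ p) P)
    (hfm₀₁ : ∀ p, AEStronglyMeasurable (f₀₁ p) P) (hfm₁₁ : ∀ p, AEStronglyMeasurable (f₁₁ p) P)
    (hfb₀₀ : ∀ p ξ, |f₀₀ p ξ| ≤ Mf) (hfb₁₀ : ∀ p ξ, |f₁₀ p ξ| ≤ Mf) (hfb₀₁ : ∀ p ξ, |f₀₁ p ξ| ≤ Mf) (hfb₁₁ : ∀ p ξ, |f₁₁ p ξ| ≤ Mf)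
    (hd₀₀ : ∀ ξ, F₀₀ ξ = ∑ p ∈ s, c p * f₀₀ p ξ) (hd₁₀ : ∀ ξ, F₁₀ ξ = ∑ p ∈ s, c p * f₁₀ p ξ)
    (hd₀₁ : ∀ ξ, F₀₁ ξ = ∑ p ∈ s, c p * f₀₁ p ξ) (hd₁₁ : ∀ ξ, F₁₁ ξ = ∑ p ∈ s, c p * f₁₁ p ξ)
    (hm₀₀ : m₀₀ = ∑ p ∈ s, c p * fb₀₀ p) (hm₁₀ : m₁₀ = ∑ p ∈ s, c p * fb₁₀ p)
    (hm₀₁ : m₀₁ = ∑ p ∈ s, c p * fb₀₁ p) (hm₁₁ : m₁₁ = ∑ p ∈ s, c p * fb₁₁ p) :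
    |(∫ ξ, (F₁₁ ξ - m₁₁) ^ 2 * w₁₁ ξ ∂P) - (∫ ξ, (F₁₀ ξ - m₁₀) ^ 2 * w₁₀ ξ ∂P) - (∫ ξ, (F₀₁ ξ - m₀₁) ^ 2 * w₀₁ ξ ∂P)
        + (∫ ξ, (F₀₀ ξ - m₀₀) ^ 2 * w₀₀ ξ ∂P)|
      ≤ (∑ p ∈ s, |c p| * |∫ ξ, ((f₁₁ p ξ + f₁₀ p ξ + f₀₁ p ξ - f₀₀ p ξ) - (fb₁₁ p + fb₁₀ p + fb₀₁ p - fb₀₀ p))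
            * ((((F₁₁ ξ - F₁₀ ξ - F₀₁ ξ + F₀₀ ξ) - (m₁₁ - m₁₀ - m₀₁ + m₀₀))) * w₁₁ ξ) ∂P|)
        + 2 * |∫ ξ, ((F₁₀ ξ - F₀₀ ξ) - (m₁₀ - m₀₀)) * ((F₀₁ ξ - F₀₀ ξ) - (m₀₁ - m₀₀)) * w₁₁ ξ ∂P|
        + (∑ p ∈ s, |c p| * |∫ ξ, ((f₁₀ p ξ + f₀₀ p ξ) - (fb₁₀ p + fb₀₀ p)) * (((F₁₀ ξ - F₀₀ ξ) - (m₁₀ - m₀₀)) * (w₁₁ ξ - w₁₀ ξ)) ∂P|)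
        + (∑ p ∈ s, |c p| * |∫ ξ, ((f₀₁ p ξ + f₀₀ p ξ) - (fb₀₁ p + fb₀₀ p)) * (((F₀₁ ξ - F₀₀ ξ) - (m₀₁ - m₀₀)) * (w₁₁ ξ - w₀₁ ξ)) ∂P|)
        + (∑ p ∈ s, ∑ q ∈ s, |c p| * |c q| * |∫ ξ, ((f₀₀ p ξ - fb₀₀ p) * (f₀₀ q ξ - fb₀₀ q) - κ p q) * (w₁₁ ξ - w₁₀ ξ - w₀₁ ξ + w₀₀ ξ) ∂P|) := by
  rw [fibreVar_secondDiff_eq P F₀₀ F₁₀ F₀₁ F₁₁ w₀₀ w₁₀ w₀₁ w₁₁ M m₀₀ m₁₀ m₀₁ m₁₁ 0 0 (∑ p ∈ s, ∑ q ∈ s, c p * c q * κ p q)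
    hF₀₀ hF₁₀ hF₀₁ hF₁₁ hb₀₀ hb₁₀ hb₀₁ hb₁₁ hw₀₀ hw₁₀ hw₀₁ hw₁₁ hn₀₀ hn₁₀ hn₀₁ hn₁₁]
  -- bounds on the pinned legs
  have hM : ∀ ξ, 0 ≤ M := fun ξ => (abs_nonneg _).trans (hb₀₀ ξ)
  have hΔΔb : ∀ ξ, |(F₁₁ ξ - F₁₀ ξ - F₀₁ ξ + F₀₀ ξ) - (m₁₁ - m₁₀ - m₀₁ + m₀₀)| ≤ 4 * M + |m₁₁ - m₁₀ - m₀₁ + m₀₀| := by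
    intro ξ
    have h1 := abs_le.mp (hb₁₁ ξ); have h2 := abs_le.mp (hb₁₀ ξ); have h3 := abs_le.mp (hb₀₁ ξ); have h4 := abs_le.mp (hb₀₀ ξ)
    refine (abs_sub _ _).trans (add_le_add ?_ le_rfl)
    rw [abs_le]; constructor <;> linarith only [h1.1, h1.2, h2.1, h2.2, h3.1, h3.2, h4.1, h4.2]
  have hΔ₁b : ∀ ξ, |(F₁₀ ξ - F₀₀ ξ) - (m₁₀ - m₀₀)| ≤ 2 * M + |m₁₀ - m₀₀| := by
    intro ξ
    have h2 := abs_le.mp (hb₁₀ ξ); have h4 := abs_le.mp (hb₀₀ ξ)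
    refine (abs_sub _ _).trans (add_le_add ?_ le_rfl)
    rw [abs_le]; constructor <;> linarith only [h2.1, h2.2, h4.1, h4.2]
  have hΔ₂b : ∀ ξ, |(F₀₁ ξ - F₀₀ ξ) - (m₀₁ - m₀₀)| ≤ 2 * M + |m₀₁ - m₀₀| := by
    intro ξ
    have h3 := abs_le.mp (hb₀₁ ξ); have h4 := abs_le.mp (hb₀₀ ξ)
    refine (abs_sub _ _).trans (add_le_add ?_ le_rfl)
    rw [abs_le]; constructor <;> linarith only [h3.1, h3.2, h4.1, h4.2]
  have mΔΔ : AEStronglyMeasurable (fun ξ => (F₁₁ ξ - F₁₀ ξ - F₀₁ ξ + F₀₀ ξ) - (m₁₁ - m₁₀ - m₀₁ + m₀₀)) P :=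
    (((hF₁₁.sub hF₁₀).sub hF₀₁).add hF₀₀).sub aestronglyMeasurable_const
  have mΔ₁ : AEStronglyMeasurable (fun ξ => (F₁₀ ξ - F₀₀ ξ) - (m₁₀ - m₀₀)) P := (hF₁₀.sub hF₀₀).sub aestronglyMeasurable_const
  have mΔ₂ : AEStronglyMeasurable (fun ξ => (F₀₁ ξ - F₀₀ ξ) - (m₀₁ - m₀₀)) P := (hF₀₁.sub hF₀₀).sub aestronglyMeasurable_const
  -- the three integrable «pinned leg × weight» factors
  have iu₁ : Integrable (fun ξ => ((F₁₁ ξ - F₁₀ ξ - F₀₁ ξ + F₀₀ ξ) - (m₁₁ - m₁₀ - m₀₁ + m₀₀)) * w₁₁ ξ) P := integrable_bdd_mul mΔΔ hΔΔb hw₁₁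
  have iu₃ : Integrable (fun ξ => ((F₁₀ ξ - F₀₀ ξ) - (m₁₀ - m₀₀)) * (w₁₁ ξ - w₁₀ ξ)) P := integrable_bdd_mul mΔ₁ hΔ₁b (hw₁₁.sub hw₁₀)
  have iu₄ : Integrable (fun ξ => ((F₀₁ ξ - F₀₀ ξ) - (m₀₁ - m₀₀)) * (w₁₁ ξ - w₀₁ ξ)) P := integrable_bdd_mul mΔ₂ hΔ₂b (hw₁₁.sub hw₀₁)
  -- channel 1: the centred sum is `Σ c p·(fS p − fbS p)`
  have t1 : |∫ ξ, ((F₁₁ ξ - F₁₀ ξ - F₀₁ ξ + F₀₀ ξ) - (m₁₁ - m₁₀ - m₀₁ + m₀₀))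
        * ((F₁₁ ξ - m₁₁) + (F₁₀ ξ - m₁₀) + (F₀₁ ξ - m₀₁) - (F₀₀ ξ - m₀₀)) * w₁₁ ξ ∂P|
      ≤ ∑ p ∈ s, |c p| * |∫ ξ, ((f₁₁ p ξ + f₁₀ p ξ + f₀₁ p ξ - f₀₀ p ξ) - (fb₁₁ p + fb₁₀ p + fb₀₁ p - fb₀₀ p))
            * ((((F₁₁ ξ - F₁₀ ξ - F₀₁ ξ + F₀₀ ξ) - (m₁₁ - m₁₀ - m₀₁ + m₀₀))) * w₁₁ ξ) ∂P| := by
    have e : (∫ ξ, ((F₁₁ ξ - F₁₀ ξ - F₀₁ ξ + F₀₀ ξ) - (m₁₁ - m₁₀ - m₀₁ + m₀₀))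
          * ((F₁₁ ξ - m₁₁) + (F₁₀ ξ - m₁₀) + (F₀₁ ξ - m₀₁) - (F₀₀ ξ - m₀₀)) * w₁₁ ξ ∂P)
        = ∫ ξ, ((F₁₁ ξ + F₁₀ ξ + F₀₁ ξ - F₀₀ ξ) - ∑ p ∈ s, c p * (fb₁₁ p + fb₁₀ p + fb₀₁ p - fb₀₀ p))
            * ((((F₁₁ ξ - F₁₀ ξ - F₀₁ ξ + F₀₀ ξ) - (m₁₁ - m₁₀ - m₀₁ + m₀₀))) * w₁₁ ξ) ∂P := by
      have hms : m₁₁ + m₁₀ + m₀₁ - m₀₀ = ∑ p ∈ s, c p * (fb₁₁ p + fb₁₀ p + fb₀₁ p - fb₀₀ p) := by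
        rw [hm₁₁, hm₁₀, hm₀₁, hm₀₀, ← Finset.sum_add_distrib, ← Finset.sum_add_distrib, ← Finset.sum_sub_distrib]
        exact Finset.sum_congr rfl (fun p _ => by ring)
      refine integral_congr_ae (Filter.Eventually.of_forall (fun ξ => ?_))
      rw [← hms]; ring
    rw [e]
    refine abs_integral_sum_centred_mul_le P s c (fun p => fb₁₁ p + fb₁₀ p + fb₀₁ p - fb₀₀ p)
      (fun p ξ => f₁₁ p ξ + f₁₀ p ξ + f₀₁ p ξ - f₀₀ p ξ) (fun ξ => F₁₁ ξ + F₁₀ ξ + F₀₁ ξ - F₀₀ ξ) _ (4 * Mf)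
      (fun p => (((hfm₁₁ p).add (hfm₁₀ p)).add (hfm₀₁ p)).sub (hfm₀₀ p)) (fun p ξ => ?_) iu₁ (fun ξ => ?_)
    · have h1 := abs_le.mp (hfb₁₁ p ξ); have h2 := abs_le.mp (hfb₁₀ p ξ); have h3 := abs_le.mp (hfb₀₁ p ξ); have h4 := abs_le.mp (hfb₀₀ p ξ)
      rw [abs_le]; constructor <;> linarith only [h1.1, h1.2, h2.1, h2.2, h3.1, h3.2, h4.1, h4.2]
    · rw [hd₁₁ ξ, hd₁₀ ξ, hd₀₁ ξ, hd₀₀ ξ, ← Finset.sum_add_distrib, ← Finset.sum_add_distrib, ← Finset.sum_sub_distrib]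
      exact Finset.sum_congr rfl (fun p _ => by ring)
  -- channel 3: `(u₁₀ + u₀₀) = (F₁₀ + F₀₀) − Σ c p·(fb₁₀ p + fb₀₀ p)`
  have t3 : |∫ ξ, (((F₁₀ ξ - F₀₀ ξ) - (m₁₀ - m₀₀)) * ((F₁₀ ξ - m₁₀) + (F₀₀ ξ - m₀₀)) - 0) * (w₁₁ ξ - w₁₀ ξ) ∂P|
      ≤ ∑ p ∈ s, |c p| * |∫ ξ, ((f₁₀ p ξ + f₀₀ p ξ) - (fb₁₀ p + fb₀₀ p)) * (((F₁₀ ξ - F₀₀ ξ) - (m₁₀ - m₀₀)) * (w₁₁ ξ - w₁₀ ξ)) ∂P| := by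
    have e : (∫ ξ, (((F₁₀ ξ - F₀₀ ξ) - (m₁₀ - m₀₀)) * ((F₁₀ ξ - m₁₀) + (F₀₀ ξ - m₀₀)) - 0) * (w₁₁ ξ - w₁₀ ξ) ∂P)
        = ∫ ξ, ((F₁₀ ξ + F₀₀ ξ) - ∑ p ∈ s, c p * (fb₁₀ p + fb₀₀ p)) * (((F₁₀ ξ - F₀₀ ξ) - (m₁₀ - m₀₀)) * (w₁₁ ξ - w₁₀ ξ)) ∂P := by
      have hms : m₁₀ + m₀₀ = ∑ p ∈ s, c p * (fb₁₀ p + fb₀₀ p) := by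
        rw [hm₁₀, hm₀₀, ← Finset.sum_add_distrib]
        exact Finset.sum_congr rfl (fun p _ => by ring)
      refine integral_congr_ae (Filter.Eventually.of_forall (fun ξ => ?_))
      rw [← hms]; ring
    rw [e]
    refine abs_integral_sum_centred_mul_le P s c (fun p => fb₁₀ p + fb₀₀ p) (fun p ξ => f₁₀ p ξ + f₀₀ p ξ)
      (fun ξ => F₁₀ ξ + F₀₀ ξ) _ (2 * Mf) (fun p => (hfm₁₀ p).add (hfm₀₀ p)) (fun p ξ => ?_) iu₃ (fun ξ => ?_)
    · have h2 := abs_le.mp (hfb₁₀ p ξ); have h4 := abs_le.mp (hfb₀₀ p ξ)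
      rw [abs_le]; constructor <;> linarith only [h2.1, h2.2, h4.1, h4.2]
    · rw [hd₁₀ ξ, hd₀₀ ξ, ← Finset.sum_add_distrib]
      exact Finset.sum_congr rfl (fun p _ => by ring)
  -- channel 4: the mirror image
  have t4 : |∫ ξ, (((F₀₁ ξ - F₀₀ ξ) - (m₀₁ - m₀₀)) * ((F₀₁ ξ - m₀₁) + (F₀₀ ξ - m₀₀)) - 0) * (w₁₁ ξ - w₀₁ ξ) ∂P|
      ≤ ∑ p ∈ s, |c p| * |∫ ξ, ((f₀₁ p ξ + f₀₀ p ξ) - (fb₀₁ p + fb₀₀ p)) * (((F₀₁ ξ - F₀₀ ξ) - (m₀₁ - m₀₀)) * (w₁₁ ξ - w₀₁ ξ)) ∂P| := by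
    have e : (∫ ξ, (((F₀₁ ξ - F₀₀ ξ) - (m₀₁ - m₀₀)) * ((F₀₁ ξ - m₀₁) + (F₀₀ ξ - m₀₀)) - 0) * (w₁₁ ξ - w₀₁ ξ) ∂P)
        = ∫ ξ, ((F₀₁ ξ + F₀₀ ξ) - ∑ p ∈ s, c p * (fb₀₁ p + fb₀₀ p)) * (((F₀₁ ξ - F₀₀ ξ) - (m₀₁ - m₀₀)) * (w₁₁ ξ - w₀₁ ξ)) ∂P := by
      have hms : m₀₁ + m₀₀ = ∑ p ∈ s, c p * (fb₀₁ p + fb₀₀ p) := by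
        rw [hm₀₁, hm₀₀, ← Finset.sum_add_distrib]
        exact Finset.sum_congr rfl (fun p _ => by ring)
      refine integral_congr_ae (Filter.Eventually.of_forall (fun ξ => ?_))
      rw [← hms]; ring
    rw [e]
    refine abs_integral_sum_centred_mul_le P s c (fun p => fb₀₁ p + fb₀₀ p) (fun p ξ => f₀₁ p ξ + f₀₀ p ξ)
      (fun ξ => F₀₁ ξ + F₀₀ ξ) _ (2 * Mf) (fun p => (hfm₀₁ p).add (hfm₀₀ p)) (fun p ξ => ?_) iu₄ (fun ξ => ?_)
    · have h3 := abs_le.mp (hfb₀₁ p ξ); have h4 := abs_le.mp (hfb₀₀ p ξ)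
      rw [abs_le]; constructor <;> linarith only [h3.1, h3.2, h4.1, h4.2]
    · rw [hd₀₁ ξ, hd₀₀ ξ, ← Finset.sum_add_distrib]
      exact Finset.sum_congr rfl (fun p _ => by ring)
  -- channel 5: the quadratic split
  have t5 := abs_integral_sqsum_centred_mul_le P s c fb₀₀ f₀₀ κ F₀₀ (fun ξ => w₁₁ ξ - w₁₀ ξ - w₀₁ ξ + w₀₀ ξ) m₀₀ Mf
    hfm₀₀ hfb₀₀ (((hw₁₁.sub hw₁₀).sub hw₀₁).add hw₀₀) hd₀₀ hm₀₀
  -- assemble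
  calc |(∫ ξ, ((F₁₁ ξ - F₁₀ ξ - F₀₁ ξ + F₀₀ ξ) - (m₁₁ - m₁₀ - m₀₁ + m₀₀))
            * ((F₁₁ ξ - m₁₁) + (F₁₀ ξ - m₁₀) + (F₀₁ ξ - m₀₁) - (F₀₀ ξ - m₀₀)) * w₁₁ ξ ∂P)
        + 2 * (∫ ξ, ((F₁₀ ξ - F₀₀ ξ) - (m₁₀ - m₀₀)) * ((F₀₁ ξ - F₀₀ ξ) - (m₀₁ - m₀₀)) * w₁₁ ξ ∂P)
        + (∫ ξ, (((F₁₀ ξ - F₀₀ ξ) - (m₁₀ - m₀₀)) * ((F₁₀ ξ - m₁₀) + (F₀₀ ξ - m₀₀)) - 0) * (w₁₁ ξ - w₁₀ ξ) ∂P)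
        + (∫ ξ, (((F₀₁ ξ - F₀₀ ξ) - (m₀₁ - m₀₀)) * ((F₀₁ ξ - m₀₁) + (F₀₀ ξ - m₀₀)) - 0) * (w₁₁ ξ - w₀₁ ξ) ∂P)
        + (∫ ξ, ((F₀₀ ξ - m₀₀) ^ 2 - ∑ p ∈ s, ∑ q ∈ s, c p * c q * κ p q) * (w₁₁ ξ - w₁₀ ξ - w₀₁ ξ + w₀₀ ξ) ∂P)|
      ≤ |∫ ξ, ((F₁₁ ξ - F₁₀ ξ - F₀₁ ξ + F₀₀ ξ) - (m₁₁ - m₁₀ - m₀₁ + m₀₀))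
            * ((F₁₁ ξ - m₁₁) + (F₁₀ ξ - m₁₀) + (F₀₁ ξ - m₀₁) - (F₀₀ ξ - m₀₀)) * w₁₁ ξ ∂P|
        + |2 * (∫ ξ, ((F₁₀ ξ - F₀₀ ξ) - (m₁₀ - m₀₀)) * ((F₀₁ ξ - F₀₀ ξ) - (m₀₁ - m₀₀)) * w₁₁ ξ ∂P)|
        + |∫ ξ, (((F₁₀ ξ - F₀₀ ξ) - (m₁₀ - m₀₀)) * ((F₁₀ ξ - m₁₀) + (F₀₀ ξ - m₀₀)) - 0) * (w₁₁ ξ - w₁₀ ξ) ∂P|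
        + |∫ ξ, (((F₀₁ ξ - F₀₀ ξ) - (m₀₁ - m₀₀)) * ((F₀₁ ξ - m₀₁) + (F₀₀ ξ - m₀₀)) - 0) * (w₁₁ ξ - w₀₁ ξ) ∂P|
        + |∫ ξ, ((F₀₀ ξ - m₀₀) ^ 2 - ∑ p ∈ s, ∑ q ∈ s, c p * c q * κ p q) * (w₁₁ ξ - w₁₀ ξ - w₀₁ ξ + w₀₀ ξ) ∂P| := by
          refine le_trans (abs_add_le _ _) (add_le_add (le_trans (abs_add_le _ _) (add_le_add (le_trans (abs_add_le _ _)
            (add_le_add (abs_add_le _ _) le_rfl)) le_rfl)) le_rfl)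
    _ ≤ _ := by
          rw [abs_mul, abs_two]
          exact add_le_add (add_le_add (add_le_add (add_le_add t1 le_rfl) t3) t4) t5

end Summit.QuantumFields.YangMills.Theorems.FluctuationComparisonRegPrIntLOrganTangentFibreVarianceSquareSlots

end
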